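import Summits.SmoothPoincare4.SmoothPoincare4.Theorems.SoloInformedFiveDimensionalRoute
import Summits.SmoothPoincare4.SmoothPoincare4.Theorems.SoloInformedPoenaruDeduction
import HarnessLib
import HarnessLib.Audit.Tags

/-!
# The Schoenflies conjecture in Gabai's ball form, as a named conjecture, and SPC4 from it

Host summit `SmoothPoincare4` (soloist seat `solo-SmoothPoincare4-informed`).  D. Gabai,
*3-Spheres in the 4-Sphere and Pseudo-Isotopies of `S¹ × S³`*, arXiv:2212.02004v2 (2024), §13
p. 62: *"A Schoenflies 4-ball is a Poincaré 4-ball that embeds in `S⁴`"* (Def. 1.3: a Poincaré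
4-ball is a compact contractible 4-manifold with boundary `S³`); the smooth 4-dimensional
Schoenflies conjecture is the assertion that every Schoenflies ball is diffeomorphic to `B⁴`
(equivalently: every smoothly embedded `S³ ⊂ S⁴` bounds a smooth 4-ball on each side — each closed
complementary region is a compact 4-manifold with boundary the given `S³`, embedded in `S⁴`).

This file NAMES that statement as the `@[conjecture]` constant `SchoenfliesBallConjectureFour`
(the main theorem of `SoloInformedFiveDimensionalRoute.lean` carries it as an inline hypothesis)
and restates the kernel-checked deduction of that file with the named hypothesis:

  `smoothPoincare4_of_poincareBallDouble_of_schoenfliesBallConjecture :`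
  `PoincareBallDoubleConjecture → SchoenfliesBallConjectureFour → cerf_twistedSphere_four →`
  `SmoothPoincare4`.

STATUS: `SchoenfliesBallConjectureFour` is OPEN.  It is implied by SPC4 (classical: both closed
complementary regions of a smooth `S³ ⊂ Σ⁴ ≅ S⁴` are homotopy balls, and a homotopy 4-ball with
boundary `S³` inside `S⁴` is a ball iff its union with the other side is `S⁴`, by Cerf / Palais);
that converse is not formalised here.  Relation to the tree's equator form
`SmoothSchoenfliesConjectureFour` (`SPC4Wave0.lean`): equivalent by the Jordan–Brouwer separation
theorem and Palais' disc theorem; not formalised here (it needs the composition of smooth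
embeddings across model changes, absent from Mathlib: `proof_wanted IsSmoothEmbedding.comp`).

## References

* D. Gabai, *3-Spheres in the 4-Sphere and Pseudo-Isotopies of `S¹ × S³`*, arXiv:2212.02004v2
  (2024), §13 p. 62 and Def. 1.3 p. 3. [cite: Gabai2022, §13 p. 62]
-/

noncomputable section

open scoped Manifold ContDiff Topology
open Set Function ContinuousMap

namespace Summit.SmoothPoincare4.SmoothPoincare4.Theorems

open Literature.Topology.FourManifolds

/-- OPEN CONJECTURE — **the smooth 4-dimensional Schoenflies conjecture in Gabai's ball form**
(Gabai 2022, p. 62: *"A Schoenflies 4-ball is a Poincaré 4-ball that embeds in `S⁴`"*; Def. 1.3;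
the Schoenflies conjecture asserts that every smooth `S³ ⊂ S⁴` bounds a ball on each side,
equivalently that every Schoenflies ball is diffeomorphic to `B⁴`).  Typed: every compact
Hausdorff second-countable smooth 4-manifold with boundary `W` whose boundary is diffeomorphic to
`S³` and which smoothly embeds in the round `S⁴` is diffeomorphic to the closed 4-disc
(contractibility is then automatic and is not assumed).  Not dischargeable: use as a hypothesis.
[cite: Gabai2022, §13 p. 62 and Def. 1.3] -/
@[conjecture] def SchoenfliesBallConjectureFour : Prop :=
  ∀ (W : Type) [TopologicalSpace W] [T2Space W] [SecondCountableTopology W]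
    [ChartedSpace (EuclideanHalfSpace (3 + 1)) W] [IsManifold (𝓡∂ (3 + 1)) ∞ W] [CompactSpace W]
    (b : BoundaryData (𝓡∂ (3 + 1)) W (𝓡 3)),
    Nonempty (b.carrier ≃ₘ⟮𝓡 3, 𝓡 3⟯ (Metric.sphere (0 : EuclideanSpace ℝ (Fin (3 + 1))) 1)) →
    (∃ φ : W → (Metric.sphere (0 : EuclideanSpace ℝ (Fin (3 + 1 + 1))) 1),
      Manifold.IsSmoothEmbedding (𝓡∂ (3 + 1)) (𝓡 (3 + 1)) ∞ φ) →
    Nonempty (W ≃ₘ⟮𝓡∂ (3 + 1), 𝓡∂ (3 + 1)⟯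
      (Metric.closedBall (0 : EuclideanSpace ℝ (Fin (3 + 1))) 1))

/-- **SPC4 from the Poincaré-ball double conjecture (Gabai Conj. 13.1, double form) and the
Schoenflies conjecture (Gabai's ball form), given Cerf's `Γ₄ = 0`** — the named-hypothesis form of
`smoothPoincare4_of_poincareBallDouble_of_schoenfliesBall` (`SoloInformedFiveDimensionalRoute.lean`,
where the puncturing, the contractibility of the punctured homotopy sphere, the transfer and the
twisted-sphere assembly are proved).  Gabai 2022, §13 p. 62: *"SPC4 follows from the Schoenflies
conjecture and the Poincaré ball embedding conjecture."* [cite: Gabai2022, §13 p. 62] -/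
theorem smoothPoincare4_of_poincareBallDouble_of_schoenfliesBallConjecture
    (hD : PoincareBallDoubleConjecture) (hS : SchoenfliesBallConjectureFour)
    (hC : cerf_twistedSphere_four) : SmoothPoincare4 :=
  smoothPoincare4_of_poincareBallDouble_of_schoenfliesBall hD hS hC

/-- The same with Gabai's Conj. 13.1 traced one step further back to Conj. 13.4 (Poénaru
programme, double form: (i) every contractible compact 5-dimensional 2-handlebody is `B⁵`,
`ContractibleTwoHandlebodyFiveIsBall`; (ii) the double of a Poincaré ball bounds a compact
contractible 5-dimensional 2-handlebody, `PoincareBallDoubleBoundsTwoHandlebody`), via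
`poincareBallDoubleConjecture_of_thickening` (`SoloInformedPoenaruDeduction.lean`):
`13.4(ii) → 13.4(i) → Schoenflies (ball form) → Γ₄ = 0 → SPC4`.
[cite: Gabai2022, §13 Conj. 13.4 and Remarks 13.2] -/
theorem smoothPoincare4_of_poenaru_of_schoenfliesBallConjecture
    (hB : PoincareBallDoubleBoundsTwoHandlebody) (hT : ContractibleTwoHandlebodyFiveIsBall)
    (hS : SchoenfliesBallConjectureFour) (hC : cerf_twistedSphere_four) : SmoothPoincare4 :=
  smoothPoincare4_of_poincareBallDouble_of_schoenfliesBall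
    (poincareBallDoubleConjecture_of_thickening hB hT) hS hC

end Summit.SmoothPoincare4.SmoothPoincare4.Theorems

end
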